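import Literature.NumberTheory.Sieve.BourgainSarnakZieglerCriterionProofs
import Literature.NumberTheory.LFunctions.MertensFromChebyshev
import Literature.NumberTheory.LFunctions.LiouvilleSumClassicalBound
import Mathlib.NumberTheory.ArithmeticFunction.Liouville
import HarnessLib

/-!
# `DigitPolyUniformity` (stmt-QuantumAdvantage-1392), line `Sketch` — stub `stub_bsz`

The finite Kátai–Bourgain–Sarnak–Ziegler criterion for the Liouville function (BSZ 2013, Thm 2),
**uniform in the test function** (explicit threshold `N₀` not depending on `F`), with a **free
lower cutoff `D`** on the primes used and a **free thin exceptional set `B`** of primes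
(`Σ_{p ∈ T} 1/p ≤ 1` on finite `T ⊆ B`) that are never used.  The tree's fixed-`N`, `F`-uniform
block estimate `Literature.NumberTheory.Sieve.BourgainSarnakZiegler.norm_sum_le_of_goodN` takes
any strictly increasing enumeration of primes above a cutoff, in blocks of `H_b` consecutive ones;
here: the primes of `(D, X] ∖ B`, `X = exp(log D · e^{L₁+2})`, `L₁ = max 20 (log(8/ε) + 1)`,
`τ = ε²/(256 L₁)`, `H_b = ⌈256 L₁/ε²⌉`, `D₁ = ⌈e^{10}⌉ + H_b + ⌈16 H_b L₁/ε⌉`; the tree's Mertens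
window bounds and the thinness of `B` give `L₁ - 1 ≤ L = Σ 1/qᵢ ≤ 2 L₁`.
-/

noncomputable section

namespace Summit.QuantumAdvantage.DigitPolyUniformity.Sketch

open Filter Finset
open scoped ComplexConjugate

namespace StubBsz

/-- Explicit-threshold form of the tree's block estimate
`Literature.NumberTheory.Sieve.BourgainSarnakZiegler.eventually_norm_sum_le`: if the pair
hypothesis holds at all `M = ⌊N / max(qᵢ, qᵢ')⌋` and `N` exceeds the two thresholds
`4 H J L (1/H + τ) / δ²` and `2 (∏ qᵢ) e^{-L} / δ` (which do not depend on `F`), then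
`‖∑_{m ≤ N} ν(m) F(m)‖ ≤ (√((1 + H/D) L (1/H + τ)) + e^{-L} + (H/D) L + δ) N`. [folklore] -/
theorem norm_sum_le_explicit {q : ℕ → ℕ} {H : ℕ} {F : ℕ → ℂ} {ν : ArithmeticFunction ℂ}
    (hF : ∀ n, ‖F n‖ ≤ 1) (hν : ν.IsMultiplicative)
    (hν1 : ∀ n, ‖ν n‖ ≤ 1) (hq : StrictMono q) (hH : 0 < H) {τ : ℝ} (hτ : 0 ≤ τ) {J N : ℕ}
    (hp : ∀ i < J * H, (q i).Prime) {D : ℝ} (hD : 0 < D) (hD0 : D ≤ q 0)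
    (hE : ∀ i ∈ range (J * H), ∀ i' ∈ range (J * H), i ≠ i' →
      ‖∑ y ∈ Icc 1 (N / max (q i) (q i')), F (q i * y) * conj (F (q i' * y))‖ ≤
        τ * ((N / max (q i) (q i') : ℕ) : ℝ))
    {δ : ℝ} (hδ : 0 < δ)
    (hN1 : 4 * ((H : ℝ) * J) * ((∑ i ∈ range (J * H), (1 : ℝ) / q i) * (1 / H + τ)) / δ ^ 2 ≤ N)
    (hN2 : 2 * (∏ i ∈ range (J * H), (q i : ℝ)) *
      Real.exp (-∑ i ∈ range (J * H), (1 : ℝ) / q i) / δ ≤ N) :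
    ‖∑ m ∈ Ioc 0 N, ν m * F m‖ ≤
      (Real.sqrt ((1 + H / D) * (∑ i ∈ range (J * H), (1 : ℝ) / q i) * (1 / H + τ)) +
        Real.exp (-∑ i ∈ range (J * H), (1 : ℝ) / q i) +
        H / D * (∑ i ∈ range (J * H), (1 : ℝ) / q i) + δ) * N := by
  -- adapted from BourgainSarnakZieglerCriterionProofs.eventually_norm_sum_le
  set L := ∑ i ∈ range (J * H), (1 : ℝ) / q i with hLdef
  set Q := ∏ i ∈ range (J * H), (q i : ℝ) with hQdef
  have hL0 : 0 ≤ L := Finset.sum_nonneg fun i _ => by positivity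
  have hHr : (0 : ℝ) < H := by exact_mod_cast hH
  set c := L * (1 / H + τ) with hcdef
  have hc0 : 0 ≤ c := by positivity
  set b := (H : ℝ) * J with hbdef
  have hb0 : 0 ≤ b := by positivity
  have hN0 : (0 : ℝ) ≤ N := Nat.cast_nonneg N
  refine (Literature.NumberTheory.Sieve.BourgainSarnakZiegler.norm_sum_le_of_goodN
    hF hν hν1 hq hH hτ hp hD hD0 hE).trans ?_
  -- the square-root term
  have hsq : Real.sqrt (N + H * N / D + H * J) * Real.sqrt (N * L * (1 / H + τ)) ≤
      Real.sqrt ((1 + H / D) * L * (1 / H + τ)) * N + δ / 2 * N := by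
    have e1 : (N : ℝ) + H * N / D + H * J = (1 + H / D) * N + b := by rw [hbdef]; ring
    have e2 : (N : ℝ) * L * (1 / H + τ) = N * c := by rw [hcdef]; ring
    rw [e1, e2]
    have hs : Real.sqrt ((1 + H / D) * N + b) ≤ Real.sqrt ((1 + H / D) * N) + Real.sqrt b := by
      have hx : (0 : ℝ) ≤ (1 + H / D) * N := by positivity
      rw [Real.sqrt_le_left (by positivity)]
      nlinarith [Real.sq_sqrt hx, Real.sq_sqrt hb0, Real.sqrt_nonneg ((1 + H / D) * N),
        Real.sqrt_nonneg b]
    calc Real.sqrt ((1 + H / D) * N + b) * Real.sqrt (N * c)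
        ≤ (Real.sqrt ((1 + H / D) * N) + Real.sqrt b) * Real.sqrt (N * c) :=
          mul_le_mul_of_nonneg_right hs (Real.sqrt_nonneg _)
      _ = Real.sqrt ((1 + H / D) * N) * Real.sqrt (N * c) + Real.sqrt b * Real.sqrt (N * c) := by
          ring
      _ ≤ Real.sqrt ((1 + H / D) * L * (1 / H + τ)) * N + δ / 2 * N := by
          apply add_le_add
          · rw [← Real.sqrt_mul (by positivity),
              show (1 + (H : ℝ) / D) * N * (N * c) = ((1 + H / D) * L * (1 / H + τ)) * (N * N) by
                rw [hcdef]; ring,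
              Real.sqrt_mul (by positivity), Real.sqrt_mul_self hN0]
          · rw [← Real.sqrt_mul hb0, Real.sqrt_le_left (by positivity)]
            have : b * c ≤ δ ^ 2 / 4 * N := by
              have := (div_le_iff₀ (by positivity : (0 : ℝ) < δ ^ 2)).1 hN1
              linarith
            nlinarith
  -- the sifted term
  have hsf : ((N : ℝ) + Q) * Real.exp (-L) ≤ Real.exp (-L) * N + δ / 2 * N := by
    have : Q * Real.exp (-L) ≤ δ / 2 * N := by
      have := (div_le_iff₀ hδ).1 hN2
      linarith
    nlinarith [Real.exp_pos (-L)]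
  nlinarith [hsq, hsf]

/-- A finite set of naturals `≤ X` is the initial segment of a strictly increasing sequence
(continued past the end by `X + 1 + i`). [folklore] -/
theorem exists_strictMono_enum (P : Finset ℕ) {X : ℕ} (hPX : ∀ p ∈ P, p ≤ X) :
    ∃ q : ℕ → ℕ, StrictMono q ∧ (∀ i < P.card, q i ∈ P) ∧ P ⊆ (range P.card).image q := by
  -- adapted from BourgainSarnakZieglerCriterionProofs.criterion_of_le
  classical
  set n₀ := P.card with hn₀def
  have hcard : P.card = n₀ := hn₀def.symm
  set q : ℕ → ℕ := fun i => if h : i < n₀ then (P.orderEmbOfFin hcard ⟨i, h⟩ : ℕ)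
    else X + 1 + i with hqdef
  refine ⟨q, ?_, fun i hi => ?_, fun p hp => ?_⟩
  · intro a b hab
    simp only [hqdef]
    by_cases ha : a < n₀ <;> by_cases hb : b < n₀
    · simp only [dif_pos ha, dif_pos hb]
      exact (P.orderEmbOfFin hcard).strictMono (Fin.mk_lt_mk.mpr hab)
    · simp only [dif_pos ha, dif_neg hb]
      have := hPX _ (Finset.orderEmbOfFin_mem P hcard ⟨a, ha⟩)
      omega
    · omega
    · simp only [dif_neg ha, dif_neg hb]; omega
  · simp only [hqdef, dif_pos hi]
    exact Finset.orderEmbOfFin_mem P hcard _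
  · have : p ∈ Set.range (P.orderEmbOfFin hcard) := by
      rw [Finset.range_orderEmbOfFin]; exact hp
    obtain ⟨⟨i, hi⟩, rfl⟩ := this
    exact Finset.mem_image.2 ⟨i, Finset.mem_range.2 hi, by simp only [hqdef, dif_pos hi]⟩

/-- The real, unordered pair hypothesis (primes `D < p < q ≤ H` outside `B`) implies the complex,
ordered one consumed by the block estimate (all pairs `i ≠ i'`, with a conjugate, at
`⌊N / max(qᵢ, qᵢ')⌋`), for an enumeration `q` of admissible primes. [folklore] -/
theorem pair_hyp_complex {q : ℕ → ℕ} (hq : StrictMono q) {n D H N : ℕ} {B : Set ℕ} {τ : ℝ}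
    (F : ℕ → ℝ) (hmem : ∀ i < n, (q i).Prime ∧ D < q i ∧ q i ≤ H ∧ q i ∉ B)
    (hpair : ∀ p q : ℕ, p.Prime → q.Prime → D < p → p < q → q ≤ H → p ∉ B → q ∉ B →
      |∑ m ∈ Icc 1 (N / q), F (p * m) * F (q * m)| ≤ τ * ((N / q : ℕ) : ℝ)) :
    ∀ i ∈ range n, ∀ i' ∈ range n, i ≠ i' →
      ‖∑ y ∈ Icc 1 (N / max (q i) (q i')),
          ((F (q i * y) : ℝ) : ℂ) * conj ((F (q i' * y) : ℝ) : ℂ)‖ ≤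
        τ * ((N / max (q i) (q i') : ℕ) : ℝ) := by
  intro i hi i' hi' hne
  obtain ⟨hpi, hDi, hiH, hiB⟩ := hmem i (Finset.mem_range.1 hi)
  obtain ⟨hpi', hDi', hi'H, hi'B⟩ := hmem i' (Finset.mem_range.1 hi')
  have hreal : ∑ y ∈ Icc 1 (N / max (q i) (q i')),
      ((F (q i * y) : ℝ) : ℂ) * conj ((F (q i' * y) : ℝ) : ℂ) =
      ((∑ y ∈ Icc 1 (N / max (q i) (q i')), F (q i * y) * F (q i' * y) : ℝ) : ℂ) := by
    rw [Complex.ofReal_sum]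
    refine Finset.sum_congr rfl fun y _ => ?_
    rw [Complex.conj_ofReal, Complex.ofReal_mul]
  rw [hreal, Complex.norm_real, Real.norm_eq_abs]
  rcases lt_or_gt_of_ne hne with h | h
  · have hlt : q i < q i' := hq h
    rw [max_eq_right hlt.le]
    exact hpair _ _ hpi hpi' hDi hlt hi'H hiB hi'B
  · have hlt : q i' < q i := hq h
    rw [max_eq_left hlt.le]
    calc |∑ y ∈ Icc 1 (N / q i), F (q i * y) * F (q i' * y)|
        = |∑ y ∈ Icc 1 (N / q i), F (q i' * y) * F (q i * y)| := by
          congr 1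
          exact Finset.sum_congr rfl fun y _ => mul_comm _ _
      _ ≤ τ * ((N / q i : ℕ) : ℝ) := hpair _ _ hpi' hpi hDi' hlt hiH hi'B hiB

/-- `|∑_{0 ≤ m ≤ N} λ(m) F(m)| = ‖∑_{1 ≤ m ≤ N} λ(m) F(m)‖` with `λ` and `F` cast to `ℂ`
(the term `m = 0` vanishes). [folklore] -/
theorem abs_sum_liouville_eq_norm (F : ℕ → ℝ) (N : ℕ) :
    |∑ m ∈ range (N + 1), (ArithmeticFunction.liouville m : ℝ) * F m| =
      ‖∑ m ∈ Ioc 0 N,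
        ((ArithmeticFunction.liouville : ArithmeticFunction ℤ) : ArithmeticFunction ℂ) m *
          ((F m : ℝ) : ℂ)‖ := by
  have h0 : ∑ m ∈ range (N + 1), (ArithmeticFunction.liouville m : ℝ) * F m =
      ∑ m ∈ Ioc 0 N, (ArithmeticFunction.liouville m : ℝ) * F m := by
    rw [Nat.range_succ_eq_Icc_zero, ← Finset.Ioc_insert_left (Nat.zero_le N),
      sum_insert (by simp), ArithmeticFunction.map_zero, Int.cast_zero, zero_mul, zero_add]
  rw [h0, ← Real.norm_eq_abs, ← Complex.norm_real, Complex.ofReal_sum]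
  congr 1
  refine Finset.sum_congr rfl fun m _ => ?_
  rw [Complex.ofReal_mul, Complex.ofReal_intCast, ArithmeticFunction.intCoe_apply]

/-- Mertens bookkeeping: with `X = exp(log D · e^{L₁+2})`, `D ≥ e^{10}`, a set `P₀` of primes of
`(D, X]` carrying all but at most `1` of the prime harmonic sum over `(D, X]`, enumerated
increasingly by `q` and cut into `J = ⌊#P₀/H⌋` blocks of length `H ≤ D`, the sum
`L = ∑_{i<JH} 1/qᵢ` satisfies `L₁ - 1 ≤ L ≤ 2 L₁` (the dropped `< H` primes cost `≤ H/D ≤ 1`).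
[folklore] -/
theorem L_bounds {D H J : ℕ} {L₁ X : ℝ} {P₀ : Finset ℕ} {q : ℕ → ℕ}
    (hD10 : Real.exp 10 ≤ D) (hH : 0 < H) (hHD : H ≤ D) (hL₁ : 20 ≤ L₁)
    (hX : X = Real.exp (Real.log D * Real.exp (L₁ + 2)))
    (hP₀ : P₀ ⊆ (Finset.Ioc D ⌊X⌋₊).filter Nat.Prime)
    (hP₀' : ∑ p ∈ (Finset.Ioc D ⌊X⌋₊).filter Nat.Prime, (1 : ℝ) / p ≤
      ∑ p ∈ P₀, (1 : ℝ) / p + 1)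
    (hJ : J = P₀.card / H) (hq : StrictMono q) (hqmem : ∀ i < P₀.card, q i ∈ P₀)
    (hPq : P₀ ⊆ (range P₀.card).image q) :
    L₁ - 1 ≤ ∑ i ∈ range (J * H), (1 : ℝ) / q i ∧
      ∑ i ∈ range (J * H), (1 : ℝ) / q i ≤ 2 * L₁ := by
  -- adapted from BourgainSarnakZieglerCriterionProofs.criterion_of_le
  have hDpos : (0 : ℝ) < D := (Real.exp_pos 10).trans_le hD10
  have hD1 : (1 : ℝ) ≤ D := by linarith [Real.add_one_le_exp (10 : ℝ)]
  have hlogD : 10 ≤ Real.log D := by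
    rw [Real.le_log_iff_exp_le hDpos]; exact hD10
  have hlogD0 : 0 < Real.log D := by linarith
  have hDX : (D : ℝ) ≤ X := by
    have h := Real.exp_le_exp.2
      (le_mul_of_one_le_right hlogD0.le (Real.one_le_exp (by linarith : (0 : ℝ) ≤ L₁ + 2)))
    rwa [Real.exp_log hDpos, ← hX] at h
  have hloglog : Real.log (Real.log X) - Real.log (Real.log D) = L₁ + 2 := by
    rw [hX, Real.log_exp, Real.log_mul hlogD0.ne' (Real.exp_pos _).ne', Real.log_exp]; ring
  have hJH : J * H ≤ P₀.card := by rw [hJ]; exact Nat.div_mul_le_self _ H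
  have hPmem : ∀ p ∈ P₀, D < p := fun p hp => by
    have hp' := hP₀ hp
    rw [Finset.mem_filter, Finset.mem_Ioc] at hp'
    exact hp'.1.1
  -- Mertens: the lower bound and the upper window bound for `∑_{p ∈ P₀} 1/p`
  have hlow : L₁ + 1 - 6 / Real.log D ≤ ∑ p ∈ P₀, (1 : ℝ) / p := by
    have hM := Literature.NumberTheory.LFunctions.MertensBound.loglog_sub_loglog_le_sum_inv_prime
      (by linarith [Real.add_one_le_exp (10 : ℝ)]) hDX
    rw [Nat.floor_natCast] at hM
    linarith [hloglog]
  have h6 : 6 / Real.log D ≤ 0.6 := by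
    rw [div_le_iff₀ hlogD0]; linarith
  have hup : ∑ p ∈ P₀, (1 : ℝ) / p ≤ 2 * L₁ := by
    have hM :=
      Literature.NumberTheory.LFunctions.MertensChebyshev.sum_inv_primes_window_le hD10 hDX
    rw [Nat.floor_natCast] at hM
    have h0 : ∑ p ∈ P₀, (1 : ℝ) / p ≤ ∑ p ∈ (Finset.Ioc D ⌊X⌋₊).filter Nat.Prime, (1 : ℝ) / p :=
      Finset.sum_le_sum_of_subset_of_nonneg hP₀ fun _ _ _ => by positivity
    have h1 : 0.133 / Real.log D ≤ 0.1 := by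
      rw [div_le_iff₀ hlogD0]; linarith
    have hsqrt : (1 : ℝ) ≤ Real.sqrt D := by
      rw [← Real.sqrt_one]; exact Real.sqrt_le_sqrt hD1
    have h2 : 12 / Real.sqrt D ≤ 12 := div_le_self (by norm_num) hsqrt
    linarith [hloglog]
  -- the sums over the enumeration
  have himage : ∀ s : Finset ℕ, ∑ p ∈ s.image q, (1 : ℝ) / p = ∑ i ∈ s, (1 : ℝ) / q i := fun s =>
    Finset.sum_image (f := fun p : ℕ => (1 : ℝ) / (p : ℝ)) fun i _ i' _ h => hq.injective h
  have hsub : ∑ i ∈ range (J * H), (1 : ℝ) / q i ≤ ∑ p ∈ P₀, (1 : ℝ) / p := by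
    rw [← himage]
    refine Finset.sum_le_sum_of_subset_of_nonneg (fun p hp => ?_) fun _ _ _ => by positivity
    obtain ⟨i, hi, rfl⟩ := Finset.mem_image.1 hp
    exact hqmem i (lt_of_lt_of_le (Finset.mem_range.1 hi) hJH)
  have hP : ∑ p ∈ P₀, (1 : ℝ) / p ≤ ∑ i ∈ range P₀.card, (1 : ℝ) / q i := by
    rw [← himage]
    exact Finset.sum_le_sum_of_subset_of_nonneg hPq fun _ _ _ => by positivity
  have hsplit : ∑ i ∈ range P₀.card, (1 : ℝ) / q i =
      ∑ i ∈ range (J * H), (1 : ℝ) / q i + ∑ i ∈ Ico (J * H) P₀.card, (1 : ℝ) / q i :=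
    (Finset.sum_range_add_sum_Ico _ hJH).symm
  have htail : ∑ i ∈ Ico (J * H) P₀.card, (1 : ℝ) / q i ≤ 1 := by
    have hlt : P₀.card < J * H + H := by rw [hJ]; exact Nat.lt_div_mul_add hH
    calc ∑ i ∈ Ico (J * H) P₀.card, (1 : ℝ) / q i ≤ ∑ i ∈ Ico (J * H) P₀.card, (1 : ℝ) / D :=
          Finset.sum_le_sum fun i hi => one_div_le_one_div_of_le hDpos
            (by exact_mod_cast (hPmem _ (hqmem i (Finset.mem_Ico.1 hi).2)).le)
      _ = ((P₀.card - J * H : ℕ) : ℝ) * (1 / D) := by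
          rw [Finset.sum_const, Nat.card_Ico, nsmul_eq_mul]
      _ ≤ H * (1 / D) := by
          apply mul_le_mul_of_nonneg_right _ (by positivity)
          exact_mod_cast (show P₀.card - J * H ≤ H by omega)
      _ ≤ 1 := by
          rw [← div_eq_mul_one_div, div_le_one hDpos]
          exact_mod_cast hHD
  constructor <;> linarith

/-- The endgame arithmetic: with `τ = ε²/(256 L₁)`, `H_b ≥ 256 L₁/ε²`, `D ≥ max(H_b, 16 H_b L₁/ε)`,
`L₁ ≥ max(20, log(8/ε) + 1)` and `L₁ - 1 ≤ L ≤ 2 L₁`, the constant of the block estimate at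
`δ = ε/8` is at most `ε` (indeed `≤ 5ε/8`). [folklore] -/
theorem const_bound {ε L₁ L Hb D : ℝ} (hε : 0 < ε) (hL₁ : 20 ≤ L₁)
    (hL₁ε : Real.log (8 / ε) + 1 ≤ L₁) (hHb : 256 * L₁ / ε ^ 2 ≤ Hb) (hHbD : Hb ≤ D)
    (hD16 : 16 * Hb * L₁ / ε ≤ D) (hD : 0 < D) (hLlo : L₁ - 1 ≤ L) (hLhi : L ≤ 2 * L₁) :
    Real.sqrt ((1 + Hb / D) * L * (1 / Hb + ε ^ 2 / (256 * L₁))) + Real.exp (-L) +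
      Hb / D * L + ε / 8 ≤ ε := by
  have hL₁0 : 0 < L₁ := by linarith
  have hL0 : 0 < L := by linarith
  have ht0 : 0 < 256 * L₁ / ε ^ 2 := by positivity
  have hHb0 : 0 < Hb := ht0.trans_le hHb
  have h1 : 1 / Hb ≤ ε ^ 2 / (256 * L₁) := by
    have := one_div_le_one_div_of_le ht0 hHb
    rwa [one_div_div] at this
  have h2 : Hb / D ≤ 1 := (div_le_one hD).2 hHbD
  -- the square-root term
  have hsq : Real.sqrt ((1 + Hb / D) * L * (1 / Hb + ε ^ 2 / (256 * L₁))) ≤ ε / 4 := by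
    have ha : 1 + Hb / D ≤ 2 := by linarith
    have hc : 1 / Hb + ε ^ 2 / (256 * L₁) ≤ 2 * (ε ^ 2 / (256 * L₁)) := by linarith
    have hprod : (1 + Hb / D) * L * (1 / Hb + ε ^ 2 / (256 * L₁)) ≤
        2 * (2 * L₁) * (2 * (ε ^ 2 / (256 * L₁))) :=
      mul_le_mul (mul_le_mul ha hLhi hL0.le (by norm_num)) hc (by positivity) (by positivity)
    have heq : 2 * (2 * L₁) * (2 * (ε ^ 2 / (256 * L₁))) = ε ^ 2 / 32 := by
      field_simp
      ring
    rw [Real.sqrt_le_left (by positivity)]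
    rw [heq] at hprod
    nlinarith [sq_nonneg ε]
  -- the sifted term
  have hexp : Real.exp (-L) ≤ ε / 8 := by
    have h8 : 0 < 8 / ε := by positivity
    calc Real.exp (-L) ≤ Real.exp (-Real.log (8 / ε)) := Real.exp_le_exp.2 (by linarith)
      _ = ε / 8 := by rw [Real.exp_neg, Real.exp_log h8, inv_div]
  -- the bad term
  have hbad : Hb / D * L ≤ ε / 8 := by
    have h16 : 16 * Hb * L₁ ≤ D * ε := (div_le_iff₀ hε).1 hD16
    calc Hb / D * L ≤ Hb / D * (2 * L₁) := mul_le_mul_of_nonneg_left hLhi (by positivity)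
      _ ≤ ε / 8 := by
          rw [div_mul_eq_mul_div, div_le_iff₀ hD]
          nlinarith
  linarith [hsq, hexp, hbad]

end StubBsz

open StubBsz in
/-- **Stub `stub_bsz` (λ-elimination): the finite Kátai–Bourgain–Sarnak–Ziegler criterion for the
Liouville function, uniform in the test function, with a free lower prime cutoff and a free thin
exceptional set of primes.** For every `ε > 0` there are `τ > 0` and `D₁` such that for every
cutoff `D ≥ D₁` and every set `B` with `Σ_{p ∈ T} 1/p ≤ 1` for all finite `T ⊆ B` there are `H`
and `N₀` with: for all `N ≥ N₀` and every `1`-bounded `F : ℕ → ℝ` whose prime dilates at the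
primes of `(D, H] ∖ B` decorrelate — `|Σ_{1 ≤ m ≤ N/q} F(pm)F(qm)| ≤ τ ⌊N/q⌋` for all primes
`D < p < q ≤ H` not in `B` — one has `|Σ_{0 ≤ m ≤ N} λ(m) F(m)| ≤ ε N`.  Proof: the tree's
fixed-`N`, `F`-uniform block estimate `BourgainSarnakZiegler.norm_sum_le_of_goodN` for `ν = λ` and
the primes of `(D, exp(log D · e^{L₁+2})] ∖ B` in blocks of `⌈256 L₁/ε²⌉` consecutive ones,
`τ = ε²/(256 L₁)`, `L₁ = max 20 (log(8/ε) + 1)`; the Mertens window bounds and the thinness of `B`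
pin `L₁ - 1 ≤ Σ 1/qᵢ ≤ 2 L₁`. [cite: BourgainSarnakZiegler2013, Theorem 2] -/
theorem stub_bsz :
    ∀ ε : ℝ, 0 < ε → ∃ τ : ℝ, 0 < τ ∧ ∃ D₁ : ℕ, ∀ D : ℕ, D₁ ≤ D → ∀ B : Set ℕ,
      (∀ T : Finset ℕ, (∀ p ∈ T, p ∈ B) → ∑ p ∈ T, (1 : ℝ) / p ≤ 1) → ∃ H : ℕ, ∃ N₀ : ℕ,
      ∀ N : ℕ, N₀ ≤ N → ∀ F : ℕ → ℝ, (∀ m, |F m| ≤ 1) →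
        (∀ p q : ℕ, p.Prime → q.Prime → D < p → p < q → q ≤ H → p ∉ B → q ∉ B →
          |∑ m ∈ Icc 1 (N / q), F (p * m) * F (q * m)| ≤ τ * ((N / q : ℕ) : ℝ)) →
        |∑ m ∈ range (N + 1), (ArithmeticFunction.liouville m : ℝ) * F m| ≤ ε * N := by
  intro ε hε
  classical
  -- the parameters depending on `ε` only
  set L₁ : ℝ := max 20 (Real.log (8 / ε) + 1) with hL₁def
  have hL₁20 : 20 ≤ L₁ := le_max_left _ _
  have hL₁ε : Real.log (8 / ε) + 1 ≤ L₁ := le_max_right _ _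
  have hL₁0 : 0 < L₁ := by linarith
  set Hb : ℕ := ⌈256 * L₁ / ε ^ 2⌉₊ with hHbdef
  have hHbge : 256 * L₁ / ε ^ 2 ≤ Hb := Nat.le_ceil _
  have hHbpos : 0 < Hb := Nat.ceil_pos.2 (by positivity)
  set τ : ℝ := ε ^ 2 / (256 * L₁) with hτdef
  have hτ0 : 0 < τ := by positivity
  refine ⟨τ, hτ0, ⌈Real.exp 10⌉₊ + Hb + ⌈16 * (Hb : ℝ) * L₁ / ε⌉₊, fun D hD B hB => ?_⟩
  -- facts about the cutoff `D`
  have hD10 : Real.exp 10 ≤ D :=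
    (Nat.le_ceil _).trans (by exact_mod_cast (show ⌈Real.exp 10⌉₊ ≤ D by omega))
  have hHbD : Hb ≤ D := by omega
  have hD16 : 16 * (Hb : ℝ) * L₁ / ε ≤ D :=
    (Nat.le_ceil _).trans (by exact_mod_cast (show ⌈16 * (Hb : ℝ) * L₁ / ε⌉₊ ≤ D by omega))
  have hDpos : (0 : ℝ) < D := (Real.exp_pos 10).trans_le hD10
  have hD1 : (1 : ℝ) ≤ D := by linarith [Real.add_one_le_exp (10 : ℝ)]
  -- the primes of `(D, X] ∖ B`, enumerated increasingly, in `J` blocks of `Hb`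
  set X : ℝ := Real.exp (Real.log D * Real.exp (L₁ + 2)) with hXdef
  set A : Finset ℕ := (Finset.Ioc D ⌊X⌋₊).filter Nat.Prime with hAdef
  obtain ⟨P₀, hP₀def⟩ : ∃ P₀ : Finset ℕ, P₀ = A.filter (fun p => p ∉ B) := ⟨_, rfl⟩
  have hP₀A : P₀ ⊆ A := hP₀def ▸ Finset.filter_subset _ _
  have hPmem : ∀ p ∈ P₀, p.Prime ∧ D < p ∧ p ≤ ⌊X⌋₊ ∧ p ∉ B := fun p hp => by
    rw [hP₀def, Finset.mem_filter, hAdef, Finset.mem_filter, Finset.mem_Ioc] at hp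
    exact ⟨hp.1.2, hp.1.1.1, hp.1.1.2, hp.2⟩
  have hP₀low : ∑ p ∈ A, (1 : ℝ) / p ≤ ∑ p ∈ P₀, (1 : ℝ) / p + 1 := by
    rw [hP₀def, ← Finset.sum_filter_add_sum_filter_not A (fun p => p ∈ B)]
    have hT : ∑ p ∈ A.filter (fun p => p ∈ B), (1 : ℝ) / p ≤ 1 :=
      hB _ fun p hp => (Finset.mem_filter.1 hp).2
    linarith
  obtain ⟨q, hq, hqmem, hPq⟩ :=
    exists_strictMono_enum P₀ (X := ⌊X⌋₊) (fun p hp => (hPmem p hp).2.2.1)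
  set J : ℕ := P₀.card / Hb with hJdef
  have hJH : J * Hb ≤ P₀.card := Nat.div_mul_le_self _ Hb
  have hmem : ∀ i < J * Hb, (q i).Prime ∧ D < q i ∧ q i ≤ ⌊X⌋₊ ∧ q i ∉ B := fun i hi =>
    hPmem _ (hqmem i (lt_of_lt_of_le hi hJH))
  -- the prime harmonic sum (its size forces `J * Hb > 0`), the modulus, the thresholds
  set L : ℝ := ∑ i ∈ range (J * Hb), (1 : ℝ) / q i with hLdef
  set Q : ℝ := ∏ i ∈ range (J * Hb), (q i : ℝ) with hQdef
  have hLb : L₁ - 1 ≤ L ∧ L ≤ 2 * L₁ :=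
    L_bounds hD10 hHbpos hHbD hL₁20 hXdef hP₀A hP₀low hJdef hq hqmem hPq
  have hJH0 : 0 < J * Hb := by
    refine Nat.pos_of_ne_zero fun h0 => ?_
    have hL00 : L = 0 := by rw [hLdef, h0, Finset.sum_range_zero]
    linarith [hLb.1]
  have hDq0 : D ≤ q 0 := (hmem 0 hJH0).2.1.le
  have hδ : (0 : ℝ) < ε / 8 := by positivity
  refine ⟨⌊X⌋₊, ⌈4 * ((Hb : ℝ) * J) * (L * (1 / Hb + τ)) / (ε / 8) ^ 2⌉₊ +
    ⌈2 * Q * Real.exp (-L) / (ε / 8)⌉₊, fun N hN F hF1 hpair => ?_⟩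
  have hN1 : 4 * ((Hb : ℝ) * J) * (L * (1 / Hb + τ)) / (ε / 8) ^ 2 ≤ N :=
    (Nat.le_ceil _).trans (by exact_mod_cast
      (show ⌈4 * ((Hb : ℝ) * J) * (L * (1 / Hb + τ)) / (ε / 8) ^ 2⌉₊ ≤ N by omega))
  have hN2 : 2 * Q * Real.exp (-L) / (ε / 8) ≤ N :=
    (Nat.le_ceil _).trans (by exact_mod_cast (show ⌈2 * Q * Real.exp (-L) / (ε / 8)⌉₊ ≤ N by omega))
  -- the block estimate for `ν = λ` and `F` cast to `ℂ`
  have hF : ∀ n, ‖((F n : ℝ) : ℂ)‖ ≤ 1 := fun n => by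
    rw [Complex.norm_real, Real.norm_eq_abs]; exact hF1 n
  have hν1 : ∀ n, ‖((ArithmeticFunction.liouville : ArithmeticFunction ℤ) :
      ArithmeticFunction ℂ) n‖ ≤ 1 := fun n => by
    rw [ArithmeticFunction.intCoe_apply, Complex.norm_intCast]
    exact Literature.NumberTheory.LFunctions.LiouvilleSum.abs_liouville_le_one n
  have key := norm_sum_le_explicit (F := fun n => ((F n : ℝ) : ℂ))
    (ν := ((ArithmeticFunction.liouville : ArithmeticFunction ℤ) : ArithmeticFunction ℂ))
    hF ArithmeticFunction.isMultiplicative_liouville.intCast hν1 hq hHbpos hτ0.le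
    (fun i hi => (hmem i hi).1) hDpos (by exact_mod_cast hDq0) (pair_hyp_complex hq F hmem hpair)
    hδ hN1 hN2
  have hconst := const_bound hε hL₁20 hL₁ε hHbge (by exact_mod_cast hHbD) hD16 hDpos hLb.1 hLb.2
  rw [abs_sum_liouville_eq_norm]
  exact key.trans (mul_le_mul_of_nonneg_right hconst (Nat.cast_nonneg N))

end Summit.QuantumAdvantage.DigitPolyUniformity.Sketch

end
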